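import Mathlib
import Summits.KontsevichZagierPeriods.Zeta5Search.DenomLaw.PathWeightProfile
import Summits.KontsevichZagierPeriods.Zeta5Search.StaircaseCells
import HarnessLib

/-!
# ζ(5) search — `C⋆` on the first-period θ-cells of TOP_STAIR #3 (profile checks over the 5,040 vertex orderings)

Cell `pub-zeta5` (HONEST FRAMING: systematic search; no irrationality claim unless certified), TRACK «DENOM-LAW» D1 prover seat
(denom-prover-d1 g14, `HOME/denom-law/prover-d1/ATTEMPT-14.md`).  The PATH ACCOUNTING node's combinatorial datum `C⋆_p(b) = cStar b p` on
TOP_STAIR #3, `b(n) = n·(85; 35,32,30,27,25,22,20) = bRay ts3 n` (parameters `c_i·n`, `c = (35,32,30,27,25,22,20)`; pair blocks `(85 − c_i − c_k)·n`):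
by the tree's profile tool `cStar_le_of_profile` (`DenomLaw/PathWeightProfile`, g11), a lower bound `p > θ₀ n` restricts which parameters (`c_i > θ₀`)
and which pair blocks (`85 − c_i − c_k > θ₀`) may reach `p`, and one `decide +kernel` over the 5,040 orderings bounds `C⋆`: `≤ 10` for `p > 25n`, `≤ 9`
for `p > 26n`, `≤ 8` for `p > 28n`, `≤ 6` for `p > 30n`, `≤ 5` for `p > 32n` (each attained on the next cell: `HOME/…/g14/tables/ts3_cells_n24.txt`;
on `(21.5n, 25n]` the tree's generic `cStar_le_eleven` is sharp).  Consumed by `DenomLaw/TS3RayPath`.  Pure combinatorics; nothing about ζ(5) or irrationality.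
-/

open Finset

namespace Summit.KontsevichZagierPeriods.Zeta5Search.StairTS3

open Summit.KontsevichZagierPeriods.Zeta5Search.DenomLaw (cStar)
open Summit.KontsevichZagierPeriods.Zeta5Search.DenomLaw.FirstPeriodKit (cStar_le_of_profile)
open Summit.KontsevichZagierPeriods.Zeta5Search.StaircaseCells (bRay ts3)

/-- The ray's lower parameters: `b(n)_{i+1} = c_i · n` for `i < 7`, `c = (35,32,30,27,25,22,20)` (written as a vector literal; no definition). -/
theorem ts3_param (n : ℕ) (i : Fin 7) : bRay ts3 n (i.val + 1) = ((![35, 32, 30, 27, 25, 22, 20] : Fin 7 → ℕ) i : ℤ) * n := by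
  fin_cases i <;> simp [bRay, ts3] <;> ring

/-- The ray's pair blocks: `85n − c_i n − c_k n = (85 − c_i − c_k)·n` (as an integer identity). -/
theorem ts3_block (n : ℕ) (i k : Fin 7) :
    bRay ts3 n 0 - bRay ts3 n (i.val + 1) - bRay ts3 n (k.val + 1) = (85 - ((![35, 32, 30, 27, 25, 22, 20] : Fin 7 → ℕ) i : ℤ) - (![35, 32, 30, 27, 25, 22, 20] : Fin 7 → ℕ) k) * n := by
  rw [ts3_param, ts3_param]; simp [bRay, ts3]; ring

/-- Profile bound: for `p > θ₀·n`, only parameters with `c_i > θ₀` and blocks with `85 − c_i − c_k > θ₀` can reach `p`, so `C⋆ ≤ K` once the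
5,040-ordering check at that profile passes. -/
theorem cStar_ts3_le_of {n p θ₀ K : ℕ} (hp : θ₀ * n < p)
    (hdec : ((List.finRange 7).permutations'.all fun l : List (Fin 7) => decide (
      ((univ : Finset (Fin 5)).filter fun t => θ₀ < (![35, 32, 30, 27, 25, 22, 20] : Fin 7 → ℕ) (l.getD (t.val + 1) 0)).card +
      ((univ : Finset (Fin 6)).filter fun t => θ₀ + (![35, 32, 30, 27, 25, 22, 20] : Fin 7 → ℕ) (l.getD t.val 0) + (![35, 32, 30, 27, 25, 22, 20] : Fin 7 → ℕ) (l.getD (t.val + 1) 0) < 85).card ≤ K)) = true) :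
    cStar (bRay ts3 n) p ≤ K := by
  refine cStar_le_of_profile (fun i : Fin 7 => θ₀ < (![35, 32, 30, 27, 25, 22, 20] : Fin 7 → ℕ) i) (fun i k : Fin 7 => θ₀ + (![35, 32, 30, 27, 25, 22, 20] : Fin 7 → ℕ) i + (![35, 32, 30, 27, 25, 22, 20] : Fin 7 → ℕ) k < 85) K ?_ ?_ hdec
  · intro i hi
    rw [ts3_param] at hi
    have hp' : (θ₀ * n : ℤ) < p := by exact_mod_cast hp
    by_contra hc
    push Not at hc
    have hc' : ((![35, 32, 30, 27, 25, 22, 20] : Fin 7 → ℕ) i : ℤ) ≤ θ₀ := by exact_mod_cast hc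
    have hn : (0 : ℤ) ≤ n := by positivity
    nlinarith
  · intro i k hik
    rw [ts3_block] at hik
    have hp' : (θ₀ * n : ℤ) < p := by exact_mod_cast hp
    by_contra hc
    push Not at hc
    have hc' : (85 : ℤ) - (![35, 32, 30, 27, 25, 22, 20] : Fin 7 → ℕ) i - (![35, 32, 30, 27, 25, 22, 20] : Fin 7 → ℕ) k ≤ θ₀ := by
      have : (85 : ℤ) ≤ θ₀ + (![35, 32, 30, 27, 25, 22, 20] : Fin 7 → ℕ) i + (![35, 32, 30, 27, 25, 22, 20] : Fin 7 → ℕ) k := by exact_mod_cast hc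
      linarith
    have hn : (0 : ℤ) ≤ n := by positivity
    nlinarith

/-- **`C⋆ ≤ 10` for `p > 25n`** (attained on `(25n, 26n]`). -/
theorem cStar_ts3_le_ten {n p : ℕ} (hp : 25 * n < p) : cStar (bRay ts3 n) p ≤ 10 :=
  cStar_ts3_le_of hp (by decide +kernel)

/-- **`C⋆ ≤ 9` for `p > 26n`** (attained on `(26n, 28n]`). -/
theorem cStar_ts3_le_nine {n p : ℕ} (hp : 26 * n < p) : cStar (bRay ts3 n) p ≤ 9 :=
  cStar_ts3_le_of hp (by decide +kernel)

/-- **`C⋆ ≤ 8` for `p > 28n`** (attained on `(28n, 30n]`). -/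
theorem cStar_ts3_le_eight {n p : ℕ} (hp : 28 * n < p) : cStar (bRay ts3 n) p ≤ 8 :=
  cStar_ts3_le_of hp (by decide +kernel)

/-- **`C⋆ ≤ 6` for `p > 30n`** (attained on `(30n, 32n]`). -/
theorem cStar_ts3_le_six {n p : ℕ} (hp : 30 * n < p) : cStar (bRay ts3 n) p ≤ 6 :=
  cStar_ts3_le_of hp (by decide +kernel)

/-- **`C⋆ ≤ 5` for `p > 32n`** (attained on `(32n, 35n]`). -/
theorem cStar_ts3_le_five {n p : ℕ} (hp : 32 * n < p) : cStar (bRay ts3 n) p ≤ 5 :=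
  cStar_ts3_le_of hp (by decide +kernel)

end Summit.KontsevichZagierPeriods.Zeta5Search.StairTS3
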